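import Mathlib
import HarnessLib
import Summits.HubbardSuperconductivity.HubbardSuperconductivity.Theorems.KLProgrammeKLRegimeEnginePairTransferRelResAnalytic
import Summits.HubbardSuperconductivity.HubbardSuperconductivity.Theorems.KLProgrammeKLRegimeEnginePairLadderRelativeReframe
import Summits.HubbardSuperconductivity.HubbardSuperconductivity.Theorems.KLProgrammeKLRegimeSplitEdgeFactsIdxLines

/-!
# Route `KLProgramme` — ENGINE child gen 8 (stmt-HubbardSuperconductivity-20437 `KLRegimeEngineV17F2`), skeleton v2 class #5 rev 3, Ẽ-organisation STEP:
# the relative source SPLIT — `pairTransferRelResIdx_family_succ_of_analytic_split`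
# (cell gate-hubbard-kl, seat hubbard-kl-k3c1-p1 g12, technique «composed-map remainder propagation»; KLTC-INDEX §C «Riccati-defect sups ξᵢ and the smearing-Lipschitz
# sizes of the member difference (relative source)»)

WHY.  In `pairTransferRelResIdx_family_succ_of_analytic` (p605267) the relative Riccati defect of the pair's flow enters through two rows — its sup `ξ` and its time
integral `I` — on the composite expression `S_j·(1 + diag a·A_{j′}) + A_j·diag a·S_{j′} − S_{j′}` (`Sᵢ = Ȧᵢ + Aᵢ·diag ḃᵢ·Aᵢ` the members' Riccati defects, `a` the
running relative weight).  By `kltc_relSource_le_unif` (p590850) that expression is `≤ ξΔ + mA·(ξ₁ + ξ₂)·Σ_c‖a(t)_c‖` with `ξΔ ≥ ‖S_j − S_{j′}‖` the DIFFERENCE of the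
two members' Riccati defects (every term of which carries a `D = s_{j′,j}`-line: the «smearing-Lipschitz size of the member difference at the source level»), and the
mass of the running relative weight is a MODEL row: `Σ_c‖a(t)_c‖ ≤ Σ_c‖a(0)_c‖ + 2¹⁰·klIdxMass n j′ ≤ (4 + 2¹⁰)·klIdxMass n j′` (`kltc_sum_norm_le_of_rate`,
`klmf_sum_norm_relRate_le_idx`, `klmf_rate_sub_eq`; `a(0) = −(tₙ^{K_{n+1}}[s_{n,j}] − tₙ^{K_{n+1}}[s_{n,j′}])` by `klmf_relWeight_data` + `softSymbolCompl_succ_add_slice`,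
mass `≤ 4·klIdxMass n j′` by `sum_abs_klTransferWeight_compl_sub_le` at frame `K_{n+1}`).  So:
* **`pairTransferRelResIdx_family_succ_of_analytic_split`** — the STEP door of p605267 with the rows (`ξ`, `I`) REPLACED by ONE row `‖(S_j − S_{j′})(t)(x,y)‖ ≤ ξΔ` and
  the analytic majorant's lower bound re-keyed on `ξ′ := ξΔ + mA(ξ₁+ξ₂)·1028·klIdxMass n j′` (its profile dressing absorbed into the factor `17/16`, since
  `mA·Σρᵢ ≤ 1/60` under the door's numeral): `Ran ≥ R₀ + (17/16)·ξ′ + (4/3)((θ·TbFlat+δ₀)e^{2mAβ′} + 2ξ′)β′(8/3)(ξ₁+ξ₂)`; everything else verbatim.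
Plumbing over landed doors; the analytic SIZES (`mA`, `ξ₁ ξ₂ ξΔ`, (F)(i) majorants, `Z ≠ 0`) stay hypotheses; nothing asserts (X).3, (c), K3 or superconductivity.  0 kit · 0 lit.
-/

noncomputable section

namespace Summit.HubbardSuperconductivity.HubbardSuperconductivity.Theorems.KLRegimeSplit

set_option linter.dupNamespace false -- summit = problem name (single-conjunct summit), D-0017

open Finset Matrix Set Literature.MathematicalPhysics.QuantumLattice Literature.Probability.LatticeModels GrassmannAlgebra
open Literature.MathematicalPhysics.QuantumLattice.FermiRG
open Summit.HubbardSuperconductivity.HubbardSuperconductivity.Theorems.KLProgrammeCooperResummation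
open Summit.HubbardSuperconductivity.HubbardSuperconductivity.Theorems.KLProgrammeLegKernels
open Summit.HubbardSuperconductivity.HubbardSuperconductivity.Theorems.DispersionFlow
open Summit.HubbardSuperconductivity.HubbardSuperconductivity.Theorems.KLRegimeWick
open Summit.HubbardSuperconductivity.HubbardSuperconductivity.Theorems.EngineV8

section Split

variable (L M : ℕ) [NeZero L] [NeZero M]

set_option maxHeartbeats 3200000 in -- very long hypothesis bundle; plumbing into `pairTransferRelResIdx_family_succ_of_analytic`
/-- **`pairTransferRelResIdx_family_succ_of_analytic_split`** — the Ẽ-organisation STEP from the analytic sizes with the relative source SPLIT into the difference of the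
two Riccati defects `ξΔ` and the transport terms (module docstring). -/
theorem pairTransferRelResIdx_family_succ_of_analytic_split
    {R : RenConsts} {N : ℕ} {G : GeoConsts} (hCF : 0 ≤ G.CF) {P : SplitConsts} (hKl : 0 ≤ P.Klam) {r : ℝ} (hr : 0 ≤ r)
    {β U μ : ℝ} {n : ℕ} {mA θ : ℝ} (hm : 0 ≤ mA) (hθ0 : 0 ≤ θ)
    (hKf : FrameOK R U N μ (klFlowFrameU L M β U μ (n + 1))) (hβ : klBetaMin ≤ β) (hβL : β ≤ L) (hη₀ : Real.pi / (L : ℝ) ≤ klScale klE0 n)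
    (hnum : mA * ((2 : ℝ) ^ 10 * 15367) ≤ 1 / 3)
    (hZ : ∀ Λ ∈ Icc (klScale klE0 (n + 1)) (klScale klE0 n), hubbardEffPartitionFnCT L M β U μ 0 (klFlowFrameU L M β U μ (n + 1)) Λ ≠ 0)
    (A A' : ℕ → TorusSite 2 L → ℝ → Matrix (TorusSite 2 L) (TorusSite 2 L) ℂ) (b b' : ℕ → TorusSite 2 L → ℝ → TorusSite 2 L → ℂ)
    (a : ℕ → ℕ → TorusSite 2 L → ℝ → TorusSite 2 L → ℂ)
    (hAdef : A = fun j Qm t => Matrix.of fun k k' : TorusSite 2 L => if k ∈ klBall L μ 0 ∧ k' ∈ klBall L μ 0 then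
      vertexFn L M β (gaussConv ℂ
        (softCovOf L M β μ (klFlowFrameU L M β U μ (n + 1)) (softSymbolCompl L M β μ (klFlowFrameU L M β U μ (n + 1)) (n + 1) j) + hubbardCovAboveCT L M β μ 0 (klFlowFrameU L M β U μ (n + 1)) (klScale klE0 (n + 1)) -
          hubbardCovAboveCT L M β μ 0 (klFlowFrameU L M β U μ (n + 1)) (klScale klE0 n + t * (klScale klE0 (n + 1) - klScale klE0 n)))
        (hubbardEffectiveActionCT L M β U μ 0 (klFlowFrameU L M β U μ (n + 1)) (klScale klE0 n + t * (klScale klE0 (n + 1) - klScale klE0 n)))) 4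
        ![(((omega0 M, k'), 0), 0), ((((omega0 M).rev, Qm - k'), 1), 0), ((((omega0 M).rev, Qm - k), 1), 1), (((omega0 M, k), 0), 1)]
      else 0)
    (hA'def : A' = fun j Qm t => Matrix.of fun k k' : TorusSite 2 L => if k ∈ klBall L μ 0 ∧ k' ∈ klBall L μ 0 then
      (klScale klE0 (n + 1) - klScale klE0 n) • -((2 : ℂ)⁻¹ * vertexFn L M β (gaussConv ℂ
        (softCovOf L M β μ (klFlowFrameU L M β U μ (n + 1)) (softSymbolCompl L M β μ (klFlowFrameU L M β U μ (n + 1)) (n + 1) j) + hubbardCovAboveCT L M β μ 0 (klFlowFrameU L M β U μ (n + 1)) (klScale klE0 (n + 1)) -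
          hubbardCovAboveCT L M β μ 0 (klFlowFrameU L M β U μ (n + 1)) (klScale klE0 n + t * (klScale klE0 (n + 1) - klScale klE0 n)))
        (grassmannDerivPairing ℂ
          (Matrix.of fun X Y : HubbardFieldIdx L M => deriv (fun Λ'' : ℝ => hubbardCovAboveCT L M β μ 0 (klFlowFrameU L M β U μ (n + 1)) Λ'' X Y)
            (klScale klE0 n + t * (klScale klE0 (n + 1) - klScale klE0 n)))
          (hubbardEffectiveActionCT L M β U μ 0 (klFlowFrameU L M β U μ (n + 1)) (klScale klE0 n + t * (klScale klE0 (n + 1) - klScale klE0 n)))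
          (hubbardEffectiveActionCT L M β U μ 0 (klFlowFrameU L M β U μ (n + 1)) (klScale klE0 n + t * (klScale klE0 (n + 1) - klScale klE0 n))))) 4
        ![(((omega0 M, k'), 0), 0), ((((omega0 M).rev, Qm - k'), 1), 0), ((((omega0 M).rev, Qm - k), 1), 1), (((omega0 M, k), 0), 1)])
      else 0)
    (hbdef : b = fun j Qm t p => -((klBubbleMass L M β μ (klFlowFrameU L M β U μ (n + 1))
        (fun k => (softSymbolCompl L M β μ (klFlowFrameU L M β U μ (n + 1)) (n + 1) j) k + (hubbardCutoffWeightCT L M β μ (klFlowFrameU L M β U μ (n + 1)) (klScale klE0 (n + 1)) k -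
          hubbardCutoffWeightCT L M β μ (klFlowFrameU L M β U μ (n + 1)) (klScale klE0 n + t * (klScale klE0 (n + 1) - klScale klE0 n)) k))
        (fun k => (softSymbolCompl L M β μ (klFlowFrameU L M β U μ (n + 1)) (n + 1) j) k + (hubbardCutoffWeightCT L M β μ (klFlowFrameU L M β U μ (n + 1)) (klScale klE0 (n + 1)) k -
          hubbardCutoffWeightCT L M β μ (klFlowFrameU L M β U μ (n + 1)) (klScale klE0 n + t * (klScale klE0 (n + 1) - klScale klE0 n)) k)) Qm p : ℝ) : ℂ))
    (hb'def : b' = fun j Qm t p => (((klScale klE0 (n + 1) - klScale klE0 n) *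
        (klBubbleMass L M β μ (klFlowFrameU L M β U μ (n + 1))
            (fun k => deriv (fun Λ' => hubbardCutoffWeightCT L M β μ (klFlowFrameU L M β U μ (n + 1)) Λ' k) (klScale klE0 n + t * (klScale klE0 (n + 1) - klScale klE0 n)))
            (fun k => (softSymbolCompl L M β μ (klFlowFrameU L M β U μ (n + 1)) (n + 1) j) k + (hubbardCutoffWeightCT L M β μ (klFlowFrameU L M β U μ (n + 1)) (klScale klE0 (n + 1)) k -
          hubbardCutoffWeightCT L M β μ (klFlowFrameU L M β U μ (n + 1)) (klScale klE0 n + t * (klScale klE0 (n + 1) - klScale klE0 n)) k)) Qm p +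
          klBubbleMass L M β μ (klFlowFrameU L M β U μ (n + 1))
            (fun k => (softSymbolCompl L M β μ (klFlowFrameU L M β U μ (n + 1)) (n + 1) j) k + (hubbardCutoffWeightCT L M β μ (klFlowFrameU L M β U μ (n + 1)) (klScale klE0 (n + 1)) k -
          hubbardCutoffWeightCT L M β μ (klFlowFrameU L M β U μ (n + 1)) (klScale klE0 n + t * (klScale klE0 (n + 1) - klScale klE0 n)) k))
            (fun k => deriv (fun Λ' => hubbardCutoffWeightCT L M β μ (klFlowFrameU L M β U μ (n + 1)) Λ' k) (klScale klE0 n + t * (klScale klE0 (n + 1) - klScale klE0 n)))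
            Qm p) : ℝ) : ℂ))
    (hadef : a = fun j j' Qm t p => (b j Qm t p - b j' Qm t p) +
      (-(((klTransferWeight L M β μ (klFlowFrameU L M β U μ (n + 1)) (n + 1) (softSymbolCompl L M β μ (klFlowFrameU L M β U μ (n + 1)) (n + 1) j) Qm p -
          klTransferWeight L M β μ (klFlowFrameU L M β U μ (n + 1)) (n + 1) (softSymbolCompl L M β μ (klFlowFrameU L M β U μ (n + 1)) (n + 1) j') Qm p : ℝ)) : ℂ) -
        (b j Qm 1 p - b j' Qm 1 p)))
    (ρ : ℕ → TorusSite 2 L → TorusSite 2 L → ℝ)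
    (hρdef : ρ = fun j Qm c => klRungProfile L M β μ (klFlowFrameU L M β U μ (n + 1)) n (softSymbolCompl L M β μ (klFlowFrameU L M β U μ (n + 1)) (n + 1) j) Qm c)
    (ah : ℕ → ℕ → TorusSite 2 L → TorusSite 2 L → ℂ)
    (hahdef : ah = fun j j' Qm c => -(((klTransferWeight L M β μ (klFlowFrameU L M β U μ n) n (softSymbolCompl L M β μ (klFlowFrameU L M β U μ n) n j) Qm c -
            klTransferWeight L M β μ (klFlowFrameU L M β U μ n) n (softSymbolCompl L M β μ (klFlowFrameU L M β U μ n) n j') Qm c : ℝ)) : ℂ))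
    (hhist : ∀ j j' : ℕ, n ≤ j' → j' ≤ j → j ≤ nScales β + 1 → ∀ Qm : TorusSite 2 L, IsPairClassAt L Qm n →
      ∀ k ∈ klBall L μ 0, ∀ k' ∈ klBall L μ 0,
      ‖(klMemberArrayF L M β U μ n (softSymbolCompl L M β μ (klFlowFrameU L M β U μ n) n j) Qm + klMemberArrayF L M β U μ n (softSymbolCompl L M β μ (klFlowFrameU L M β U μ n) n j) Qm *
          diagonal (fun c => -(((klTransferWeight L M β μ (klFlowFrameU L M β U μ n) n (softSymbolCompl L M β μ (klFlowFrameU L M β U μ n) n j) Qm c -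
            klTransferWeight L M β μ (klFlowFrameU L M β U μ n) n (softSymbolCompl L M β μ (klFlowFrameU L M β U μ n) n j') Qm c : ℝ)) : ℂ)) * klMemberArrayF L M β U μ n (softSymbolCompl L M β μ (klFlowFrameU L M β U μ n) n j') Qm -
          klMemberArrayF L M β U μ n (softSymbolCompl L M β μ (klFlowFrameU L M β U μ n) n j') Qm) k k'‖ ≤ θ * transferBarRelIdx L G P r β U n j' Qm k k')
    (hdata : ∀ j j' : ℕ, n + 1 ≤ j' → j' ≤ j → j ≤ nScales β + 1 → ∀ Qm : TorusSite 2 L, IsPairClassAt L Qm (n + 1) →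
      ∃ (ηr η₁ η₂ R₀ Ran : TorusSite 2 L → TorusSite 2 L → ℝ) (d : TorusSite 2 L → ℝ) (δ₀ ξΔ ξ₁ ξ₂ : ℝ),
        0 ≤ ξ₁ ∧ 0 ≤ ξ₂ ∧
        -- ANALYTIC: a priori size of the two member arrays along the slice; the two Riccati-defect sups
        (∀ t ∈ Icc (0 : ℝ) 1, ∀ x y, ‖A j Qm t x y‖ ≤ mA) ∧ (∀ t ∈ Icc (0 : ℝ) 1, ∀ x y, ‖A j' Qm t x y‖ ≤ mA) ∧
        (∀ t ∈ Icc (0 : ℝ) 1, ∀ x y, ‖(A' j Qm t + A j Qm t * diagonal (b' j Qm t) * A j Qm t) x y‖ ≤ ξ₁) ∧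
        (∀ t ∈ Icc (0 : ℝ) 1, ∀ x y, ‖(A' j' Qm t + A j' Qm t * diagonal (b' j' Qm t) * A j' Qm t) x y‖ ≤ ξ₂) ∧
        -- the history array's a priori size; the START RE-FRAME majorants ((F)(i) lane) against the history objects at frame `K_n`, and their sup `δ₀`
        (∀ x y, ‖klMemberArrayF L M β U μ n (softSymbolCompl L M β μ (klFlowFrameU L M β U μ n) n j) Qm x y‖ ≤ mA) ∧
        (∀ x y, ‖((A j Qm 0 - klMemberArrayF L M β U μ n (softSymbolCompl L M β μ (klFlowFrameU L M β U μ n) n j) Qm) - (A j' Qm 0 - klMemberArrayF L M β U μ n (softSymbolCompl L M β μ (klFlowFrameU L M β U μ n) n j') Qm)) x y‖ ≤ ηr x y) ∧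
        (∀ x y, ‖(A j Qm 0 - klMemberArrayF L M β U μ n (softSymbolCompl L M β μ (klFlowFrameU L M β U μ n) n j) Qm) x y‖ ≤ η₁ x y) ∧
        (∀ x y, ‖(A j' Qm 0 - klMemberArrayF L M β U μ n (softSymbolCompl L M β μ (klFlowFrameU L M β U μ n) n j') Qm) x y‖ ≤ η₂ x y) ∧
        (∀ c, ‖a j j' Qm 0 c - ah j j' Qm c‖ ≤ d c) ∧
        (∀ x y, (ηr x y + mA * ∑ c, η₁ x c * (d c + ‖ah j j' Qm c‖) + mA * mA * ∑ c, d c + mA * ∑ c, ‖ah j j' Qm c‖ * η₂ c y) ≤ R₀ x y) ∧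
        (∀ x y, R₀ x y ≤ δ₀) ∧
        -- ANALYTIC: the DIFFERENCE of the two Riccati defects along the slice (every term carries a `D`-line)
        (∀ t ∈ Icc (0 : ℝ) 1, ∀ x y, ‖((A' j Qm t + A j Qm t * diagonal (b' j Qm t) * A j Qm t) - (A' j' Qm t + A j' Qm t * diagonal (b' j' Qm t) * A j' Qm t)) x y‖ ≤ ξΔ) ∧
        -- the ANALYTIC majorant `Ran` (re-frame part + the relative source `ξ′ := ξΔ + mA(ξ₁+ξ₂)·1028·klIdxMass n j′` dressed + the transport constant)
        (∀ x y, R₀ x y + 17 / 16 * (ξΔ + mA * (ξ₁ + ξ₂) * (1028 * klIdxMass n j')) +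
            4 / 3 * ((θ * (klIdxPrefactor r n * ((P.Klam * U) ^ 2 * ((2 * ((n : ℝ) + 2) + ((2 : ℝ) ^ n)⁻¹ + ((L : ℝ))⁻¹) * klIdxMass n j' + ((4 : ℝ) ^ n)⁻¹ * klIdxOverlap n j') +
              ((P.Klam * |U|) ^ 3 * ((2 : ℝ) ^ n)⁻¹ + thermalBar G P U β n) * klIdxMass n j')) + δ₀) * Real.exp (mA * ((2 : ℝ) ^ 10 * 15367) + mA * ((2 : ℝ) ^ 10 * 15367)) + 2 * (ξΔ + mA * (ξ₁ + ξ₂) * (1028 * klIdxMass n j'))) * ((2 : ℝ) ^ 10 * 15367) * (8 / 3 * ξ₁ + 8 / 3 * ξ₂) ≤ Ran x y) ∧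
        -- ITS budget: the four-term FT form of `Ran` against the frame slack of the inherited bar plus three fifths of the slice's ROOM
        (∀ k ∈ klBall L μ 0, ∀ k' ∈ klBall L μ 0,
          Ran k k' + ∑ c, Ran k c * ρ j' Qm c * (3 / 2 * mA) + ∑ a', 3 / 2 * mA * ρ j Qm a' * Ran a' k' +
              ∑ a', ∑ c, 3 / 2 * mA * ρ j Qm a' * Ran a' c * ρ j' Qm c * (3 / 2 * mA) ≤
            θ * (((2 : ℝ) ^ (n + 2))⁻¹ * transferBarRelIdx L G P r β U n j' Qm k k' + 3 / 5 *
              (klIdxPrefactor r (n + 1) * ((P.Klam * U) ^ 2 *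
              ((min (klTorusNorm L (k - k') / klScale klE0 (n + 1)) (klScale klE0 (n + 1) / klTorusNorm L (k - k')) +
                  min (klTorusNorm L (k + k' - Qm) / klScale klE0 (n + 1)) (klScale klE0 (n + 1) / klTorusNorm L (k + k' - Qm)) +
                  ((2 : ℝ) ^ n)⁻¹ + 3 * ((L : ℝ))⁻¹) * klIdxMass n j' + ((4 : ℝ) ^ (n + 1))⁻¹ * klIdxOverlap (n + 1) j') +
            ((P.Klam * |U|) ^ 3 * ((2 : ℝ) ^ n)⁻¹ + 3 * thermalBar G P U β (n + 1)) * klIdxMass n j'))))) :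
    ∀ j j' : ℕ, n + 1 ≤ j' → j' ≤ j → j ≤ nScales β + 1 → ∀ Qm : TorusSite 2 L, IsPairClassAt L Qm (n + 1) →
      ∀ k ∈ klBall L μ 0, ∀ k' ∈ klBall L μ 0,
      ‖(klMemberArrayF L M β U μ (n + 1) (softSymbolCompl L M β μ (klFlowFrameU L M β U μ (n + 1)) (n + 1) j) Qm + klMemberArrayF L M β U μ (n + 1) (softSymbolCompl L M β μ (klFlowFrameU L M β U μ (n + 1)) (n + 1) j) Qm *
          diagonal (fun p => -(((klTransferWeight L M β μ (klFlowFrameU L M β U μ (n + 1)) (n + 1) (softSymbolCompl L M β μ (klFlowFrameU L M β U μ (n + 1)) (n + 1) j) Qm p -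
            klTransferWeight L M β μ (klFlowFrameU L M β U μ (n + 1)) (n + 1) (softSymbolCompl L M β μ (klFlowFrameU L M β U μ (n + 1)) (n + 1) j') Qm p : ℝ)) : ℂ)) * klMemberArrayF L M β U μ (n + 1) (softSymbolCompl L M β μ (klFlowFrameU L M β U μ (n + 1)) (n + 1) j') Qm -
          klMemberArrayF L M β U μ (n + 1) (softSymbolCompl L M β μ (klFlowFrameU L M β U μ (n + 1)) (n + 1) j') Qm) k k'‖ ≤ θ * transferBarRelIdx L G P r β U (n + 1) j' Qm k k' := by
  have h15 : ((2 : ℝ) ^ 10 * 15367) = 15735808 := by norm_num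
  have hnum' : mA * 15735808 ≤ 1 / 3 := by rw [h15] at hnum; exact hnum
  have hβ0 : 0 < β := pos_of_klBetaMin_le hβ
  refine pairTransferRelResIdx_family_succ_of_analytic L M hCF hKl hr hm hθ0 hKf hβ hβL hη₀ hnum hZ A A' b b' a hAdef hA'def hbdef hb'def hadef
    ρ hρdef ah hahdef hhist ?_
  intro j j' h1 h2 h3 Qm hQm
  obtain ⟨ηr, η₁, η₂, R₀, Ran, d, δ₀, ξΔ, ξ₁, ξ₂, hξ₁, hξ₂, hA₁, hA₂, hS₁, hS₂, hH, hηr, hη₁, hη₂, hd, hR₀, hδ₀, hΔ, hRan, hbud⟩ :=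
    hdata j j' h1 h2 h3 Qm hQm
  have hj1 : n + 1 ≤ j := h1.trans h2
  have hms := klIdxMass_nonneg n j'
  -- the relative weight's mass along the slice: `Σ_c‖a(t)_c‖ ≤ (4 + 2¹⁰)·klIdxMass n j′`
  obtain ⟨hdb₁, hcb₁, hb₁e⟩ := klmf_rung_data L M β μ (klFlowFrameU L M β U μ (n + 1)) n (softSymbolCompl L M β μ (klFlowFrameU L M β U μ (n + 1)) (n + 1) j) Qm (b j Qm) (b' j Qm)
    (by rw [hbdef]) (by rw [hb'def])
  obtain ⟨hdb₂, hcb₂, hb₂e⟩ := klmf_rung_data L M β μ (klFlowFrameU L M β U μ (n + 1)) n (softSymbolCompl L M β μ (klFlowFrameU L M β U μ (n + 1)) (n + 1) j') Qm (b j' Qm) (b' j' Qm)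
    (by rw [hbdef]) (by rw [hb'def])
  obtain ⟨hda, -, ha0⟩ := klmf_relWeight_data L M β μ (klFlowFrameU L M β U μ (n + 1)) n (softSymbolCompl L M β μ (klFlowFrameU L M β U μ (n + 1)) (n + 1) j) (softSymbolCompl L M β μ (klFlowFrameU L M β U μ (n + 1)) (n + 1) j') Qm
    (b j Qm) (b j' Qm) (b' j Qm) (b' j' Qm) (a j j' Qm) hdb₁ hdb₂ hb₁e hb₂e (by rw [hadef])
  have hrate : ∀ t ∈ Icc (0 : ℝ) 1, ∑ c, ‖b' j Qm t c - b' j' Qm t c‖ ≤ (2 : ℝ) ^ 10 * klIdxMass n j' := by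
    intro t ht
    have h := klmf_sum_norm_relRate_le_idx L M β μ (klFlowFrameU L M β U μ (n + 1)) hKf hβ hβL h1 h2 Qm ht
    refine le_of_eq_of_le (Finset.sum_congr rfl fun c _ => ?_) h
    simp only [hb'def]
    rw [klmf_rate_sub_eq L M β μ (klFlowFrameU L M β U μ (n + 1)) n]
  have ha0m : ∑ c, ‖a j j' Qm 0 c‖ ≤ 4 * klIdxMass n j' := by
    rw [ha0, softSymbolCompl_succ_add_slice, softSymbolCompl_succ_add_slice]
    have h := sum_abs_klTransferWeight_compl_sub_le (M := M) β μ (klFlowFrameU L M β U μ (n + 1)) hKf hβ hβL ((Nat.le_succ n).trans h1) h2 Qm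
    refine le_of_eq_of_le (Finset.sum_congr rfl fun c _ => ?_) h
    rw [norm_neg, Complex.norm_real, Real.norm_eq_abs]
  have hW : ∀ t ∈ Icc (0 : ℝ) 1, ∑ c, ‖a j j' Qm t c‖ ≤ 1028 * klIdxMass n j' := fun t ht => by
    have h := kltc_sum_norm_le_of_rate (a j j' Qm) (fun t p => b' j Qm t p - b' j' Qm t p) hda (fun c => (hcb₁ c).sub (hcb₂ c)) hrate ht
    have h2p : (2 : ℝ) ^ 10 = 1024 := by norm_num
    rw [h2p] at h
    linarith
  -- the relative source `ξ′`
  obtain ⟨XI, hXI⟩ : ∃ XI : ℝ, XI = (ξΔ + mA * (ξ₁ + ξ₂) * (1028 * klIdxMass n j')) := ⟨_, rfl⟩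
  have hΔ0 : 0 ≤ ξΔ := (norm_nonneg _).trans (hΔ 0 ⟨le_rfl, zero_le_one⟩ Qm Qm)
  have hXI0 : 0 ≤ XI := by rw [hXI]; positivity
  have hErel : ∀ t ∈ Icc (0 : ℝ) 1, ∀ x y, ‖(((A' j Qm t + A j Qm t * diagonal (b' j Qm t) * A j Qm t) * (1 + diagonal (a j j' Qm t) * A j' Qm t) +
            A j Qm t * diagonal (a j j' Qm t) * (A' j' Qm t + A j' Qm t * diagonal (b' j' Qm t) * A j' Qm t) - (A' j' Qm t + A j' Qm t * diagonal (b' j' Qm t) * A j' Qm t))) x y‖ ≤ XI := by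
    intro t ht x y
    have h := kltc_relSource_le_unif (A' j Qm t + A j Qm t * diagonal (b' j Qm t) * A j Qm t) (A' j' Qm t + A j' Qm t * diagonal (b' j' Qm t) * A j' Qm t) (A j Qm t) (A j' Qm t) (a j j' Qm t) hm
      (hA₁ t ht) (hA₂ t ht) (hΔ t ht) (hS₁ t ht) (hS₂ t ht) x y
    have hw : mA * (ξ₁ + ξ₂) * ∑ c, ‖a j j' Qm t c‖ ≤ mA * (ξ₁ + ξ₂) * (1028 * klIdxMass n j') :=
      mul_le_mul_of_nonneg_left (hW t ht) (by positivity)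
    rw [hXI]
    linarith
  have hI : ∀ x y, (∫ t in (0 : ℝ)..1, ‖(((A' j Qm t + A j Qm t * diagonal (b' j Qm t) * A j Qm t) * (1 + diagonal (a j j' Qm t) * A j' Qm t) +
            A j Qm t * diagonal (a j j' Qm t) * (A' j' Qm t + A j' Qm t * diagonal (b' j' Qm t) * A j' Qm t) - (A' j' Qm t + A j' Qm t * diagonal (b' j' Qm t) * A j' Qm t))) x y‖) ≤ XI := by
    intro x y
    have hb : ∀ t ∈ Set.uIoc (0 : ℝ) 1, ‖(fun t : ℝ => ‖(((A' j Qm t + A j Qm t * diagonal (b' j Qm t) * A j Qm t) * (1 + diagonal (a j j' Qm t) * A j' Qm t) +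
            A j Qm t * diagonal (a j j' Qm t) * (A' j' Qm t + A j' Qm t * diagonal (b' j' Qm t) * A j' Qm t) - (A' j' Qm t + A j' Qm t * diagonal (b' j' Qm t) * A j' Qm t))) x y‖) t‖ ≤ XI := by
      intro t ht
      rw [Set.uIoc_of_le zero_le_one] at ht
      simpa only [Real.norm_eq_abs, abs_norm] using hErel t ⟨ht.1.le, ht.2⟩ x y
    have h := intervalIntegral.norm_integral_le_of_norm_le_const hb
    rw [sub_zero, abs_one, mul_one, Real.norm_eq_abs] at h
    exact (le_abs_self _).trans h
  -- profile masses for the dressing of the constant `ξ′`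
  have hρ0 : ∀ i c, 0 ≤ ρ i Qm c := fun i c => by
    rw [hρdef]; exact klRungProfile_nonneg β μ _ hβ0 n _ Qm c
  have hZρ : ∀ i, n + 1 ≤ i → ∑ c, ρ i Qm c ≤ 738288 := fun i hi => by
    rw [hρdef]; exact sum_klRungProfile_compl_le β μ _ hKf hβ hβL hi Qm
  have hσ₁ : mA * ∑ a', ρ j Qm a' ≤ 1 / 60 := by
    have := mul_le_mul_of_nonneg_left (hZρ j hj1) hm
    linarith
  have hσ₂ : mA * ∑ c, ρ j' Qm c ≤ 1 / 60 := by
    have := mul_le_mul_of_nonneg_left (hZρ j' h1) hm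
    linarith
  have hsum10 : 0 ≤ ∑ a', ρ j Qm a' := Finset.sum_nonneg fun a' _ => hρ0 j a'
  have hsum20 : 0 ≤ ∑ c, ρ j' Qm c := Finset.sum_nonneg fun c _ => hρ0 j' c
  refine ⟨ηr, η₁, η₂, R₀, fun _ _ => XI, Ran, d, δ₀, XI, ξ₁, ξ₂, hXI0, hξ₁, hξ₂, hA₁, hA₂, hS₁, hS₂, hH, hηr, hη₁, hη₂, hd, hR₀, hδ₀,
    hErel, hI, fun x y => ?_, hbud⟩
  beta_reduce
  have e1 : ∑ c, XI * ρ j' Qm c * mA = XI * (mA * ∑ c, ρ j' Qm c) := by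
    rw [Finset.mul_sum, Finset.mul_sum]
    exact Finset.sum_congr rfl fun c _ => by ring
  have e2 : ∑ a', mA * ρ j Qm a' * XI = XI * (mA * ∑ a', ρ j Qm a') := by
    rw [Finset.mul_sum, Finset.mul_sum]
    exact Finset.sum_congr rfl fun a' _ => by ring
  have e3 : ∑ a', ∑ c, mA * ρ j Qm a' * XI * ρ j' Qm c * mA = XI * ((mA * ∑ a', ρ j Qm a') * (mA * ∑ c, ρ j' Qm c)) := by
    have inner : ∀ a', ∑ c, mA * ρ j Qm a' * XI * ρ j' Qm c * mA = (mA * ρ j Qm a' * XI * mA) * ∑ c, ρ j' Qm c := fun a' => by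
      rw [Finset.mul_sum]; exact Finset.sum_congr rfl fun c _ => by ring
    have inner2 : ∑ a', mA * ρ j Qm a' * XI * mA = (mA * XI * mA) * ∑ a', ρ j Qm a' := by
      rw [Finset.mul_sum]; exact Finset.sum_congr rfl fun a' _ => by ring
    rw [Finset.sum_congr rfl fun a' _ => inner a', ← Finset.sum_mul, inner2]
    ring
  rw [e1, e2, e3]
  have hR := hRan x y
  rw [← hXI] at hR
  have hm1 : 0 ≤ mA * ∑ a', ρ j Qm a' := mul_nonneg hm hsum10
  have hm2 : 0 ≤ mA * ∑ c, ρ j' Qm c := mul_nonneg hm hsum20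
  have hdress : XI + XI * (mA * ∑ c, ρ j' Qm c) + XI * (mA * ∑ a', ρ j Qm a') + XI * ((mA * ∑ a', ρ j Qm a') * (mA * ∑ c, ρ j' Qm c)) ≤ 17 / 16 * XI := by
    nlinarith [mul_le_mul hσ₁ hσ₂ hm2 (by norm_num : (0:ℝ) ≤ 1 / 60), mul_nonneg hXI0 hm1, mul_nonneg hXI0 hm2]
  linarith

end Split

end Summit.HubbardSuperconductivity.HubbardSuperconductivity.Theorems.KLRegimeSplit

end
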